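import Summits.QuantumFields.YangMills.Theorems.BalabanUVNodesK2EndOfChain190OwnDrift
import Summits.QuantumFields.YangMills.Theorems.BalabanUVNodesN17RunRemAtOfShiftAnchorLevel

/-!
# Crux K2⁷ `EndpointGivenBR13SepCoPH` (stmt-QuantumFields-20543) — THE RUN-ROWS SANDWICH: what the (190)-DISPLAY of the XL stub (v7 1ᴼᴿ ∕ v7c 1ᶜᴿ) BINDS,
# in the kernel, `b`-PARAMETRIC (answer to idea-5 g10's Q-v7-1, CRIT-2 g3's ADDENDUM (C1)–(C2), plan g84's asks (5c)∕(5d); hypothesis form; 0 `def`, 0 `sorry`)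

Cell pub-balaban (b2b), seat `b2b-balaban-beta-an4` (BINDER row D4 OWNER; author lineage of the (190)-socket `ChainTFac190H`, of p603015 ∕ p606097 ∕ p609486), gen 153.
Helper for crux K2⁷ = stmt-QuantumFields-20543 (`--supports … --as helper`); count-neutral; NO skeleton is registered or re-keyed by this file.

THE QUESTION (plan g84 PRECUT ∕ corner re-key draft 39189bf31904f7f3, pub-ymgap I.30362 ∕ I.30600; idea-5 g10 (H2) = Q-v7-1; CRIT-2 g3 `CRIT-2-ADDENDUM-v7-1OR-literal-reading.md`).
The XL text displays, at every in-window RG run prefix, the row-(D4) ∧ B4 LEAVES `∃ a, β_{k+1}(prefix) − b_k = secondMoment (limKernel a) μ ν ∧ Nonempty (PolLeavesTFac190H 4 M a c ℓ α₂ q)`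
with `(M, μ, ν, c, ℓ, α₂, q, γ₀)` existential AFTER the tuple.  What does that display bind?  In the kernel (all hypotheses displayed; nothing of Bałaban's asserted):
* §1 RIGHT END (consumer side) is ALREADY a tree name — p603015 §2 `runConstRemainder_of_runLeaves190H`: display ⟹ `RunConstRemainder β b (c.ε₁·K_rem,L) γ₀`; the END reads
  NOTHING ELSE of the leaves.  LEFT END (supplier side; NEW): a REPRESENTABILITY RADIUS `ρ` of the leaf class at the constants — «every `r`, `|r| ≤ ρ`, is the second moment of the limit
  kernel of SOME admissible leaf family» — displayed INLINE as the hypothesis `hrepr` (a property of the structure `PolLeavesTFac190H` and the constants ONLY; no field mentions the datum,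
  CRIT-2 (L2)) + `RunConstRemainder β b ρ γ₀` GIVES the display (`runRows_of_reprRadius_runConstRemainder`); and `ρ ≤ c.ε₁·K_rem,L` necessarily (`reprRadius_le_remCoeff`).
* §1 MODULUS BRIDGES: a run-wise modulus in the last coupling (linear `C·g_k`, or RATE-FREE `ω(g_k)`, `ω → 0`) or in the window level pays a constant remainder BY THE WINDOW
  (`runConstRemainder_of_lastSlotModulus`, `runConstRemainder_of_omegaModulus`, `runConstRemainder_of_windowBound`) — idea-5 (H3) ∕ CRIT-2 (C1): modulus suppliers are NOT orphaned.
* §2 AT THE STAGE-13 DATUM, `b`-PARAMETRIC: constants package with the cap against the slope + `hrepr` + `RunConstRemainder D.βfun b ρ γ₀` + `SurvCont` ⟹ the XL text's ∃-BLOCK relative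
  to `b` VERBATIM (`ownRunRowsBody_of_reprRadius_runConstRemainder` = CRIT-2 (C1)'s named lemma), for ANY keying of `b` (fill `fun k => D.βfun k 0⃗`, R3 `bOwnγ`, anchored corner).
* §3 THE DISPLAY-FREE ROAD TO THE CRUX DECL (CRIT-2 PRICE §4, weakest currency): drift of `b` + run-wise constant remainder below the slope on SOME window + `SurvCont` ⟹
  `EndpointGivenBR13SepCoPH` (DEF-1's `endpointExistence_of_drift_runConstRemainder_survCont` at `D.fwd`); p606097's displayed one text FACTORS through it.
* §4 CORNER EDITION (plan g84's v7c, ask (5d)): at an ANCHORED, positively drifting in-box corner sequence `b` (2ᶜᴰ's body `ScaleAnchor D.βfun b ∧ 0 < s ∧ OneLoopDrift s A b`):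
  2ᶜᴰ + (constant remainder below the slope ∕ linear modulus ∕ rate-free ω-modulus, (C) descending by node N17's `survCont_anti`) ⟹ crux decl; weak-currency suppliers ⟹ the
  REGISTERED 1ᶜᴿ text modulo `hrepr` (`cornerRunChainK_of_reprRadius_cornerRunConstRemainderK`); 1ᶜᴿ ⟹ the weak currency (`cornerRunConstRemainderK_of_cornerRunChainK`).

READING (for the registration header; the plan's pen): as TYPED, the XL text is sandwiched between two run-wise constant-remainder statements at `b` — «radius ρ(M,c,…)» ⟹ 1ᶜᴿ ⟹
«radius c.ε₁·K_rem,L ≤ s» — so the (190)-rows certify PROVENANCE OF A NUMBER within an admissible-constants radius capped by the own slope; whether toy leaf families realise a radius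
`ρ > 0` at admissible constants (the inhabitant of `hrepr`) is a CONSTRUCTION this file does NOT perform (row-D4 item (5c); NOT DONE — `hrepr` is inhabited at no constants here); the
binding coupling either way is the SHARED `c` (the cap's `ε₁` is the (2.38) constant of the displayed activities).  The analytic wall is unchanged: SOME k-uniform bound of the run
remainder below the own slope ([I] (2.13) p.268 + [II] (2.38) p.20 at the datum, or a modulus).

HONEST FRAMING.  Implications between displayed HYPOTHESIS SHAPES and elementary real-number bookkeeping; NOTHING of Bałaban's analysis is asserted or discharged; `hrepr` ∕
`RunConstRemainder` ∕ the moduli ∕ `SurvCont` ∕ the drift ∕ the anchor are hypotheses inhabited at no tuple here (instance 0∕1); (D4) NOT discharged; K2⁷ and its stubs NOT proved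
(v6 5a75a2378c79b303 registered at the time of writing; v7c = the plan's draft 39189bf31904f7f3); counts unmoved; [Balaban1987RG1] Thm 2 + (0.31) p. 259 is UNPROVED IN PRINT; route R4
closes the CONDITIONAL finite-𝕋⁴ rung `BalabanLadder.UV` only — NOT the continuum limit, NOT ℝ⁴, NOT OS, NOT the Yang–Mills mass gap, NOT Clay.  No `def`, no `instance`, no
`notation`, no `axiom`.  Sources (context only; nothing printed is used as a hypothesis): [I] = [Balaban1987RG1] CMP **109** (1987): Thm 2 p. 259, Thm 3 p. 264, (1.20)–(1.22) p. 264,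
(2.12)–(2.14) p. 268, (5.10) p. 293; [II] = [Balaban1988RG2Cluster] CMP **116** (1988): Lemma 3 (2.38) p. 20.
-/


noncomputable section

namespace Summit.QuantumFields.YangMills.Theorems.BalabanUVNodesK2RunRowsSandwich

open Literature.MathematicalPhysics.QuantumFieldTheory.Balaban1983to89
open Literature.MathematicalPhysics.QuantumFieldTheory.Balaban1983to89.FlowStep
open Literature.MathematicalPhysics.QuantumFieldTheory.Balaban1983to89.B13ScaleTransfer (Pt)
open Literature.MathematicalPhysics.QuantumFieldTheory.Balaban1983to89.DagBinding (EndpointExistence)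
open Literature.MathematicalPhysics.QuantumFieldTheory.Balaban1983to89.T4Continuum (T4Family)
open Literature.MathematicalPhysics.QuantumFieldTheory.Balaban1983to89.Beta.Drift (OneLoopDrift)
open Literature.MathematicalPhysics.QuantumFieldTheory.Balaban1983to89.Beta.RemainderChainLattice
open Literature.MathematicalPhysics.QuantumFieldTheory.Balaban1983to89.Beta.RemainderLimitTorus (LDom limKernel)
open Literature.MathematicalPhysics.QuantumFieldTheory.Balaban1983to89.Beta.RemainderLocalityHolo
open Literature.MathematicalPhysics.QuantumFieldTheory.Balaban1983to89.Beta.RemainderDecay190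
open Literature.MathematicalPhysics.QuantumFieldTheory.Balaban1983to89.Beta.RemainderDecay190HoloChain
open Summit.QuantumFields.YangMills.Theorems.BalabanUVNodesK2NamedJetsRunRemAt
  (RunConstRemainder SurvCont endpointExistence_of_drift_runConstRemainder_survCont)
open Summit.QuantumFields.YangMills.Theorems.BalabanUVNodesK2RunRemAtOfChain190 (abs_secondMoment_le_of_leaves190H runConstRemainder_of_runLeaves190H)
open Summit.QuantumFields.YangMills.Theorems.BalabanUVNodesK2EndOfChain190OwnDrift (EndpointGivenBR13SepCoPH_of_ownDriftRunChain190K)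
open Summit.QuantumFields.YangMills.BalabanUVNodes.N17RunRemAtOfShiftAnchorLevel (survCont_anti)

/-! ## §1 Generic (`β`, `b` arbitrary): the sandwich around the displayed run rows -/

section Generic

variable {d M : ℕ} [NeZero M] {μ ν : Fin d} {β : HBeta} {b : ℕ → ℝ} {c : B13.Consts} {ℓ α₂ : ℝ} {q : Consts190} {γ₀ ρ : ℝ}

/-- **LEFT END OF THE SANDWICH (supplier side)** — a REPRESENTABILITY RADIUS `ρ` of the leaf class at the constants (hypothesis `hrepr`: every real `r`, `|r| ≤ ρ`, is
the second moment of the limit kernel of SOME admissible leaf family — a property of the hypothesis structure and the constants only) together with the run-wise constant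
remainder of radius `ρ` GIVES the displayed run rows: the rows certify provenance of a NUMBER, and any admissible family supplies provenance.  (CRIT-2 ADDENDUM (L4) ∕ idea-5
Q-v7-1, kernel edition.) [folklore] -/
theorem runRows_of_reprRadius_runConstRemainder
    (hrepr : ∀ r : ℝ, |r| ≤ ρ →
      ∃ a : LDom d → Pt d → ℝ, B12Beta.secondMoment (fun _ _ => limKernel a) μ ν = r ∧ Nonempty (PolLeavesTFac190H d M a c ℓ α₂ q))
    (hrem : RunConstRemainder β b ρ γ₀) :
    ∀ (n : ℕ) (gs : ℕ → ℝ), RGEqH n β gs → Step.InInterval γ₀ n gs → ∀ k, k ≤ n →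
      ∃ a : LDom d → Pt d → ℝ, β k (prefixOf gs k) - b k = B12Beta.secondMoment (fun _ _ => limKernel a) μ ν ∧
        Nonempty (PolLeavesTFac190H d M a c ℓ α₂ q) := fun n gs hrg hI k hk => by
  obtain ⟨a, ha, hL⟩ := hrepr _ (hrem n gs hrg hI k hk)
  exact ⟨a, ha.symm, hL⟩

/-- **THE SANDWICH CLOSES ON THE END's BOUND**: a representability radius `ρ ≥ 0` at admissible constants never exceeds `c.ε₁·K_rem,L` (represent `r := ρ` and read the
END `abs_secondMoment_le_of_leaves190H`).  So `Rep(M,c,…) ⊆ [−c.ε₁·K_rem,L, c.ε₁·K_rem,L]`, as CRIT-2 (L4) says.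
[cite: Balaban1987RG1, (5.10) p.293; Balaban1988RG2Cluster, Lemma 3 (2.38) p.20] -/
theorem reprRadius_le_remCoeff
    (hrepr : ∀ r : ℝ, |r| ≤ ρ →
      ∃ a : LDom d → Pt d → ℝ, B12Beta.secondMoment (fun _ _ => limKernel a) μ ν = r ∧ Nonempty (PolLeavesTFac190H d M a c ℓ α₂ q))
    (hρ : 0 ≤ ρ) (hC : CondsL d c ℓ) (h22 : c.R22gen ℓ) (hq : q.Valid c.δ₀) (hs : SignsL c α₂ q.B₃) (hd : 0 < d) :
    ρ ≤ c.ε₁ * remCoeffL d M c α₂ q.B₃ := by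
  obtain ⟨a, ha, ⟨Lv⟩⟩ := hrepr ρ (abs_of_nonneg hρ).le
  have h := abs_secondMoment_le_of_leaves190H Lv hC h22 hq hs hd μ ν
  rw [ha, abs_of_nonneg hρ] at h
  exact h

/-- A run-wise constant remainder is MONOTONE in the radius. [folklore] -/
theorem runConstRemainder_mono_radius {r r' : ℝ} (h : RunConstRemainder β b r γ₀) (hle : r ≤ r') : RunConstRemainder β b r' γ₀ :=
  fun n gs hrg hI k hk => (h n gs hrg hI k hk).trans hle

/-- **MODULUS BRIDGE, last slot** (idea-5 (H3) ∕ CRIT-2 (C1)): a run-wise modulus LINEAR IN THE LAST COUPLING `|β_{k+1}(prefix) − b_k| ≤ C·g_k` pays the constant remainder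
`C·γ₀` on the window `]0, γ₀]` — BY THE WINDOW, at every tuple, whatever the slope; then `C·γ₀ ≤ ρ` (resp. `≤ s`) is arranged by shrinking `γ₀`.
[cite: Balaban1987RG1, (2.13) p.268 and (5.10) p.293] -/
theorem runConstRemainder_of_lastSlotModulus {C : ℝ} (hC0 : 0 ≤ C)
    (hmod : ∀ (n : ℕ) (gs : ℕ → ℝ), RGEqH n β gs → Step.InInterval γ₀ n gs → ∀ k, k ≤ n → |β k (prefixOf gs k) - b k| ≤ C * gs k) :
    RunConstRemainder β b (C * γ₀) γ₀ := fun n gs hrg hI k hk =>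
  (hmod n gs hrg hI k hk).trans (mul_le_mul_of_nonneg_left (hI k hk).2 hC0)

/-- **MODULUS BRIDGE, window level** (the (5.10)-type history modulus summed over the prefix, every entry `≤ γ₀`): a bound `ω γ₀` depending on the window level only IS a run-wise
constant remainder of radius `ω γ₀`.
[cite: Balaban1987RG1, (5.10) p.293] -/
theorem runConstRemainder_of_windowBound {ω : ℝ → ℝ}
    (hmod : ∀ (γ : ℝ) (n : ℕ) (gs : ℕ → ℝ), RGEqH n β gs → Step.InInterval γ n gs → ∀ k, k ≤ n → |β k (prefixOf gs k) - b k| ≤ ω γ) :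
    RunConstRemainder β b (ω γ₀) γ₀ := fun n gs hrg hI k hk => hmod γ₀ n gs hrg hI k hk

/-- **MODULUS BRIDGE, ω-EDITION (rate-free; idea-5's two-bound Tannery modulus)**: a run-wise modulus `|β_{k+1}(prefix) − b_k| ≤ ω(g_k)` on the level-`γ₀` runs with `ω → 0` as
`g → 0⁺` (NO rate) pays EVERY positive radius `s` on SOME smaller positive level `γ₁ ≤ γ₀` — the window pays the cap, whatever the slope (`Metric.tendsto_nhdsWithin_nhds`).
[cite: Balaban1987RG1, (2.13) p.268 and (5.10) p.293] -/
theorem runConstRemainder_of_omegaModulus {ω : ℝ → ℝ} (hω : Filter.Tendsto ω (nhdsWithin 0 (Set.Ioi 0)) (nhds 0))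
    (hmod : ∀ (n : ℕ) (gs : ℕ → ℝ), RGEqH n β gs → Step.InInterval γ₀ n gs → ∀ k, k ≤ n → |β k (prefixOf gs k) - b k| ≤ ω (gs k))
    (hγ₀ : 0 < γ₀) {s : ℝ} (hs : 0 < s) :
    ∃ γ₁ : ℝ, 0 < γ₁ ∧ γ₁ ≤ γ₀ ∧ RunConstRemainder β b s γ₁ := by
  obtain ⟨δ, hδ, hδω⟩ := Metric.tendsto_nhdsWithin_nhds.1 hω s hs
  refine ⟨min γ₀ (δ / 2), lt_min hγ₀ (by linarith), min_le_left _ _, fun n gs hrg hI k hk => ?_⟩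
  have hk0 : 0 < gs k := (hI k hk).1
  have hkδ : gs k < δ := lt_of_le_of_lt ((hI k hk).2.trans (min_le_right _ _)) (by linarith)
  have hω' : dist (ω (gs k)) 0 < s := hδω (Set.mem_Ioi.mpr hk0) (by rwa [Real.dist_eq, sub_zero, abs_of_pos hk0])
  have hI' : Step.InInterval γ₀ n gs := fun j hj => ⟨(hI j hj).1, (hI j hj).2.trans (min_le_left _ _)⟩
  calc |β k (prefixOf gs k) - b k| ≤ ω (gs k) := hmod n gs hrg hI' k hk
    _ ≤ |ω (gs k)| := le_abs_self _
    _ ≤ s := by rw [Real.dist_eq, sub_zero] at hω'; exact hω'.le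

end Generic

/-! ## §2 At the Stage-13 datum, `b`-PARAMETRIC: 1ᴼᴿ's ∃-block from a representability radius and a run-wise constant remainder -/

section Datum

variable (F : T4Family) (θ : Node00.Stage13HParams F 2) (hP : θ.Provisos₁₃SepCoPH F 2)
variable {M : ℕ} [NeZero M] {μ ν : Fin 4} {b : ℕ → ℝ} {c : B13.Consts} {ℓ α₂ : ℝ} {q : Consts190} {γ₀ ρ s : ℝ}

/-- **★ CRIT-2 (C1)'s NAMED LEMMA — the XL text's ∃-BLOCK RELATIVE TO `b` FROM the constants package with the cap against the slope, a representability radius `ρ` at those constants,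
the run-wise constant remainder of radius `ρ` of the datum's β on the window, and `SurvCont`** — conclusion VERBATIM the ∃-block of v7's 1ᴼᴿ ∕ v7c's 1ᶜᴿ ∕ p609486's `hR` ∕ p606097's
one text, for ANY `b`; so constant-road AND modulus-road suppliers feed the XL text modulo the toy-representability `hrepr` (NOT performed here).  CONDITIONAL; instance 0∕1.
[cite: Balaban1987RG1, (1.20)-(1.22) p.264, (2.12)-(2.14) p.268 and (5.10) p.293; Balaban1988RG2Cluster, Lemma 3 (2.38) p.20] -/
theorem ownRunRowsBody_of_reprRadius_runConstRemainder
    (hC : CondsL 4 c ℓ) (h22 : c.R22gen ℓ) (hq : q.Valid c.δ₀) (hs : SignsL c α₂ q.B₃) (hγ₀ : 0 < γ₀)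
    (hcap : c.ε₁ * remCoeffL 4 M c α₂ q.B₃ ≤ s)
    (hrepr : ∀ r : ℝ, |r| ≤ ρ →
      ∃ a : LDom 4 → Pt 4 → ℝ, B12Beta.secondMoment (fun _ _ => limKernel a) μ ν = r ∧ Nonempty (PolLeavesTFac190H 4 M a c ℓ α₂ q))
    (hrem : RunConstRemainder (Node00.datumOfRecord₁₃SepCoPH F 2 θ hP).βfun b ρ γ₀)
    (hcont : SurvCont (Node00.datumOfRecord₁₃SepCoPH F 2 θ hP).βfun γ₀) :
    ∃ (M : ℕ) (_ : NeZero M) (μ ν : Fin 4) (c : B13.Consts) (ℓ α₂ : ℝ) (q : Consts190) (γ₀ : ℝ),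
      (∀ (n : ℕ) (gs : ℕ → ℝ), RGEqH n (Node00.datumOfRecord₁₃SepCoPH F 2 θ hP).βfun gs → Step.InInterval γ₀ n gs → ∀ k, k ≤ n →
        ∃ a : LDom 4 → Pt 4 → ℝ, (Node00.datumOfRecord₁₃SepCoPH F 2 θ hP).βfun k (prefixOf gs k) - b k =
          B12Beta.secondMoment (fun _ _ => limKernel a) μ ν ∧ Nonempty (PolLeavesTFac190H 4 M a c ℓ α₂ q)) ∧
      CondsL 4 c ℓ ∧ c.R22gen ℓ ∧ q.Valid c.δ₀ ∧ SignsL c α₂ q.B₃ ∧ 0 < γ₀ ∧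
      c.ε₁ * remCoeffL 4 M c α₂ q.B₃ ≤ s ∧ SurvCont (Node00.datumOfRecord₁₃SepCoPH F 2 θ hP).βfun γ₀ :=
  ⟨M, inferInstance, μ, ν, c, ℓ, α₂, q, γ₀, runRows_of_reprRadius_runConstRemainder hrepr hrem, hC, h22, hq, hs, hγ₀, hcap, hcont⟩

/-- **The same, MODULUS EDITION** (idea-5 (H3): the modulus pays by the window): last-slot modulus `C` on `]0, γ₀]` with `C·γ₀ ≤ ρ` in place of `hrem`. [folklore] -/
theorem ownRunRowsBody_of_reprRadius_lastSlotModulus {C : ℝ} (hC0 : 0 ≤ C)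
    (hC : CondsL 4 c ℓ) (h22 : c.R22gen ℓ) (hq : q.Valid c.δ₀) (hs : SignsL c α₂ q.B₃) (hγ₀ : 0 < γ₀)
    (hcap : c.ε₁ * remCoeffL 4 M c α₂ q.B₃ ≤ s)
    (hrepr : ∀ r : ℝ, |r| ≤ ρ →
      ∃ a : LDom 4 → Pt 4 → ℝ, B12Beta.secondMoment (fun _ _ => limKernel a) μ ν = r ∧ Nonempty (PolLeavesTFac190H 4 M a c ℓ α₂ q))
    (hmod : ∀ (n : ℕ) (gs : ℕ → ℝ), RGEqH n (Node00.datumOfRecord₁₃SepCoPH F 2 θ hP).βfun gs → Step.InInterval γ₀ n gs → ∀ k, k ≤ n →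
      |(Node00.datumOfRecord₁₃SepCoPH F 2 θ hP).βfun k (prefixOf gs k) - b k| ≤ C * gs k)
    (hwin : C * γ₀ ≤ ρ) (hcont : SurvCont (Node00.datumOfRecord₁₃SepCoPH F 2 θ hP).βfun γ₀) :
    ∃ (M : ℕ) (_ : NeZero M) (μ ν : Fin 4) (c : B13.Consts) (ℓ α₂ : ℝ) (q : Consts190) (γ₀ : ℝ),
      (∀ (n : ℕ) (gs : ℕ → ℝ), RGEqH n (Node00.datumOfRecord₁₃SepCoPH F 2 θ hP).βfun gs → Step.InInterval γ₀ n gs → ∀ k, k ≤ n →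
        ∃ a : LDom 4 → Pt 4 → ℝ, (Node00.datumOfRecord₁₃SepCoPH F 2 θ hP).βfun k (prefixOf gs k) - b k =
          B12Beta.secondMoment (fun _ _ => limKernel a) μ ν ∧ Nonempty (PolLeavesTFac190H 4 M a c ℓ α₂ q)) ∧
      CondsL 4 c ℓ ∧ c.R22gen ℓ ∧ q.Valid c.δ₀ ∧ SignsL c α₂ q.B₃ ∧ 0 < γ₀ ∧
      c.ε₁ * remCoeffL 4 M c α₂ q.B₃ ≤ s ∧ SurvCont (Node00.datumOfRecord₁₃SepCoPH F 2 θ hP).βfun γ₀ :=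
  ownRunRowsBody_of_reprRadius_runConstRemainder F θ hP hC h22 hq hs hγ₀ hcap hrepr
    (runConstRemainder_mono_radius (runConstRemainder_of_lastSlotModulus hC0 hmod) hwin) hcont

/-- **THE SANDWICH AT THE DATUM, read back**: the XL text's ∃-block at `b` IMPLIES a run-wise constant remainder of radius `s` on some window + `SurvCont` (right end + cap).
[cite: Balaban1987RG1, (5.10) p.293; Balaban1988RG2Cluster, Lemma 3 (2.38) p.20] -/
theorem runConstRemainder_slope_of_runRowsBody
    (h : ∃ (M : ℕ) (_ : NeZero M) (μ ν : Fin 4) (c : B13.Consts) (ℓ α₂ : ℝ) (q : Consts190) (γ₀ : ℝ),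
      (∀ (n : ℕ) (gs : ℕ → ℝ), RGEqH n (Node00.datumOfRecord₁₃SepCoPH F 2 θ hP).βfun gs → Step.InInterval γ₀ n gs → ∀ k, k ≤ n →
        ∃ a : LDom 4 → Pt 4 → ℝ, (Node00.datumOfRecord₁₃SepCoPH F 2 θ hP).βfun k (prefixOf gs k) - b k =
          B12Beta.secondMoment (fun _ _ => limKernel a) μ ν ∧ Nonempty (PolLeavesTFac190H 4 M a c ℓ α₂ q)) ∧
      CondsL 4 c ℓ ∧ c.R22gen ℓ ∧ q.Valid c.δ₀ ∧ SignsL c α₂ q.B₃ ∧ 0 < γ₀ ∧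
      c.ε₁ * remCoeffL 4 M c α₂ q.B₃ ≤ s ∧ SurvCont (Node00.datumOfRecord₁₃SepCoPH F 2 θ hP).βfun γ₀) :
    ∃ γ₀ : ℝ, 0 < γ₀ ∧ RunConstRemainder (Node00.datumOfRecord₁₃SepCoPH F 2 θ hP).βfun b s γ₀ ∧
      SurvCont (Node00.datumOfRecord₁₃SepCoPH F 2 θ hP).βfun γ₀ := by
  obtain ⟨M, instM, μ, ν, c, ℓ, α₂, q, γ₀, hrun, hC, h22, hq, hs, hγ₀, hcap, hcont⟩ := h
  exact ⟨γ₀, hγ₀, runConstRemainder_mono_radius (runConstRemainder_of_runLeaves190H hrun hC h22 hq hs (by norm_num)) hcap, hcont⟩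

end Datum

/-! ## §3 The display-free road to the crux decl, `b`-parametric (CRIT-2 PRICE §4, weakest currency) -/

section Keyed

/-- **★★ DRIFT + RUN-WISE CONSTANT REMAINDER BELOW THE SLOPE + `SurvCont` ⟹ THE CRUX DECL BY NAME — NO (190)-display, NO named jets, NO κ, NO anchor, `b` a PARAMETER**
(DEF-1's `endpointExistence_of_drift_runConstRemainder_survCont` at the datum's `fwd`): the WEAKEST text any supplier of the XL stub has to meet; (B) ∕ window ∕ unity ∕
admissibility unused.  CONDITIONAL; K2⁷ NOT closed; instance 0∕1. [cite: Balaban1987RG1, Thm 2 p.259 (first sentence), Thm 3 p.264, (2.12)-(2.14) p.268 and (5.10) p.293] -/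
theorem EndpointGivenBR13SepCoPH_of_ownDrift_runConstRemainderK
    (h : ∀ (F : T4Family) (θ : Node00.Stage13HParams F 2) (hP : θ.Provisos₁₃SepCoPH F 2),
      (θ.ZhUnity F 2 ∧ θ.SlotsNondegenerate₁₃ F 2) → θ.Admissible F 2 →
      B16.EndStatementBPrinted (Node00.datumOfRecord₁₃SepCoPH F 2 θ hP).C →
      (∃ γ₁ : ℝ, 0 < γ₁ ∧ ∀ γ : ℝ, 0 < γ → γ ≤ γ₁ →
        ∃ P : B12.RunParams, 1 ≤ P.K ∧ ((Node00.datumOfRecord₁₃SepCoPH F 2 θ hP).C P).flow.InInterval γ P.K) →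
      ∃ (b : ℕ → ℝ) (s A γ₀ r : ℝ), OneLoopDrift s A b ∧ 0 < γ₀ ∧ r ≤ s ∧
        RunConstRemainder (Node00.datumOfRecord₁₃SepCoPH F 2 θ hP).βfun b r γ₀ ∧
        SurvCont (Node00.datumOfRecord₁₃SepCoPH F 2 θ hP).βfun γ₀) :
    Summit.QuantumFields.YangMills.Theses.BalabanUVNodes.EndpointGivenBR13SepCoPH := by
  intro F θ hP hU hθ hB hwin
  obtain ⟨b, s, A, γ₀, r, hdrift, hγ₀, hr, hrem, hcont⟩ := h F θ hP hU hθ hB hwin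
  exact endpointExistence_of_drift_runConstRemainder_survCont (Node00.datumOfRecord₁₃SepCoPH F 2 θ hP).fwd hγ₀ hdrift hrem hr hcont

/-- **p606097's DISPLAYED one text factors through the display-free road** (right end of the sandwich + the cap): the (190)-display is consumed as a bound and as
nothing else — the kernel form of «(NB) on the consumer side» (idea-5 Q-v7-1). [cite: Balaban1987RG1, (5.10) p.293; Balaban1988RG2Cluster, Lemma 3 (2.38) p.20] -/
theorem ownDrift_runConstRemainderK_of_ownDriftRunChain190K
    (h : ∀ (F : T4Family) (θ : Node00.Stage13HParams F 2) (hP : θ.Provisos₁₃SepCoPH F 2),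
      (θ.ZhUnity F 2 ∧ θ.SlotsNondegenerate₁₃ F 2) → θ.Admissible F 2 →
      B16.EndStatementBPrinted (Node00.datumOfRecord₁₃SepCoPH F 2 θ hP).C →
      (∃ γ₁ : ℝ, 0 < γ₁ ∧ ∀ γ : ℝ, 0 < γ → γ ≤ γ₁ →
        ∃ P : B12.RunParams, 1 ≤ P.K ∧ ((Node00.datumOfRecord₁₃SepCoPH F 2 θ hP).C P).flow.InInterval γ P.K) →
      ∃ (b : ℕ → ℝ) (s A : ℝ) (M : ℕ) (_ : NeZero M) (μ ν : Fin 4) (c : B13.Consts) (ℓ α₂ : ℝ) (q : Consts190) (γ₀ : ℝ),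
        (∀ (n : ℕ) (gs : ℕ → ℝ), RGEqH n (Node00.datumOfRecord₁₃SepCoPH F 2 θ hP).βfun gs → Step.InInterval γ₀ n gs → ∀ k, k ≤ n →
          ∃ a : LDom 4 → Pt 4 → ℝ, (Node00.datumOfRecord₁₃SepCoPH F 2 θ hP).βfun k (prefixOf gs k) - b k =
            B12Beta.secondMoment (fun _ _ => limKernel a) μ ν ∧ Nonempty (PolLeavesTFac190H 4 M a c ℓ α₂ q)) ∧
        CondsL 4 c ℓ ∧ c.R22gen ℓ ∧ q.Valid c.δ₀ ∧ SignsL c α₂ q.B₃ ∧ 0 < γ₀ ∧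
        c.ε₁ * remCoeffL 4 M c α₂ q.B₃ ≤ s ∧ OneLoopDrift s A b ∧
        SurvCont (Node00.datumOfRecord₁₃SepCoPH F 2 θ hP).βfun γ₀) :
    ∀ (F : T4Family) (θ : Node00.Stage13HParams F 2) (hP : θ.Provisos₁₃SepCoPH F 2),
      (θ.ZhUnity F 2 ∧ θ.SlotsNondegenerate₁₃ F 2) → θ.Admissible F 2 →
      B16.EndStatementBPrinted (Node00.datumOfRecord₁₃SepCoPH F 2 θ hP).C →
      (∃ γ₁ : ℝ, 0 < γ₁ ∧ ∀ γ : ℝ, 0 < γ → γ ≤ γ₁ →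
        ∃ P : B12.RunParams, 1 ≤ P.K ∧ ((Node00.datumOfRecord₁₃SepCoPH F 2 θ hP).C P).flow.InInterval γ P.K) →
      ∃ (b : ℕ → ℝ) (s A γ₀ r : ℝ), OneLoopDrift s A b ∧ 0 < γ₀ ∧ r ≤ s ∧
        RunConstRemainder (Node00.datumOfRecord₁₃SepCoPH F 2 θ hP).βfun b r γ₀ ∧
        SurvCont (Node00.datumOfRecord₁₃SepCoPH F 2 θ hP).βfun γ₀ := by
  intro F θ hP hU hθ hB hwin
  obtain ⟨b, s, A, M, instM, μ, ν, c, ℓ, α₂, q, γ₀, hrun, hC, h22, hq, hs, hγ₀, hcap, hdrift, hcont⟩ := h F θ hP hU hθ hB hwin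
  exact ⟨b, s, A, γ₀, _, hdrift, hγ₀, hcap, runConstRemainder_of_runLeaves190H hrun hC h22 hq hs (by norm_num), hcont⟩

end Keyed

/-! ## §4 CORNER EDITION (plan g84's v7c re-key 39189bf31904f7f3, ask (5d)): `b` = an anchored, positively drifting in-box corner sequence -/

section Corner

open Summit.QuantumFields.YangMills.Theorems.BalabanUVNodesK2NamedJetsRemAt (ScaleAnchor)

/-- **★★ (5d) THE CONSTANT-REMAINDER ROAD AT THE CORNER ⟹ THE CRUX DECL BY NAME, display-free currency**: 2ᶜᴰ's text (v7c :535, INLINE) and, at every anchored drifting `b`, SOME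
window `γ₀ > 0` with a run-wise constant remainder of radius `r ≤ s` and (C) on the survivors (the anchor is threaded to the supplier, NOT read by the END; `γ₀ ≤ θ.γ` not needed; the
second hypothesis is WEAKER than the registered-to-be 1ᶜᴿ :549, cf. `cornerRunConstRemainderK_of_cornerRunChainK`).  CONDITIONAL; K2⁷ NOT closed; instance 0∕1.
[cite: Balaban1987RG1, Thm 2 p.259 (first sentence), Thm 3 p.264, (2.12)-(2.14) p.268 and (5.10) p.293] -/
theorem EndpointGivenBR13SepCoPH_of_cornerDriftK_cornerRunConstRemainderK
    (h₁ : ∀ (F : T4Family) (θ : Node00.Stage13HParams F 2) (hP : θ.Provisos₁₃SepCoPH F 2),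
      (θ.ZhUnity F 2 ∧ θ.SlotsNondegenerate₁₃ F 2) → θ.Admissible F 2 →
      B16.EndStatementBPrinted (Node00.datumOfRecord₁₃SepCoPH F 2 θ hP).C →
      (∃ γ₁ : ℝ, 0 < γ₁ ∧ ∀ γ : ℝ, 0 < γ → γ ≤ γ₁ →
        ∃ P : B12.RunParams, 1 ≤ P.K ∧ ((Node00.datumOfRecord₁₃SepCoPH F 2 θ hP).C P).flow.InInterval γ P.K) →
      ∃ (b : ℕ → ℝ) (s A : ℝ), ScaleAnchor (Node00.datumOfRecord₁₃SepCoPH F 2 θ hP).βfun b ∧ 0 < s ∧ OneLoopDrift s A b)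
    (h₂ : ∀ (F : T4Family) (θ : Node00.Stage13HParams F 2) (hP : θ.Provisos₁₃SepCoPH F 2),
      (θ.ZhUnity F 2 ∧ θ.SlotsNondegenerate₁₃ F 2) → θ.Admissible F 2 →
      B16.EndStatementBPrinted (Node00.datumOfRecord₁₃SepCoPH F 2 θ hP).C →
      (∃ γ₁ : ℝ, 0 < γ₁ ∧ ∀ γ : ℝ, 0 < γ → γ ≤ γ₁ →
        ∃ P : B12.RunParams, 1 ≤ P.K ∧ ((Node00.datumOfRecord₁₃SepCoPH F 2 θ hP).C P).flow.InInterval γ P.K) →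
      ∀ (b : ℕ → ℝ) (s A : ℝ), ScaleAnchor (Node00.datumOfRecord₁₃SepCoPH F 2 θ hP).βfun b → 0 < s → OneLoopDrift s A b →
      ∃ γ₀ r : ℝ, 0 < γ₀ ∧ r ≤ s ∧ RunConstRemainder (Node00.datumOfRecord₁₃SepCoPH F 2 θ hP).βfun b r γ₀ ∧
        SurvCont (Node00.datumOfRecord₁₃SepCoPH F 2 θ hP).βfun γ₀) :
    Summit.QuantumFields.YangMills.Theses.BalabanUVNodes.EndpointGivenBR13SepCoPH := by
  intro F θ hP hU hθ hB hwin
  obtain ⟨b, s, A, hanch, hs, hdrift⟩ := h₁ F θ hP hU hθ hB hwin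
  obtain ⟨γ₀, r, hγ₀, hr, hrem, hcont⟩ := h₂ F θ hP hU hθ hB hwin b s A hanch hs hdrift
  exact endpointExistence_of_drift_runConstRemainder_survCont (Node00.datumOfRecord₁₃SepCoPH F 2 θ hP).fwd hγ₀ hdrift hrem hr hcont

/-- **(5d), LINEAR-MODULUS CURRENCY**: 2ᶜᴰ and, at every anchored drifting `b`, SOME window `γ₀ > 0` and `C ≥ 0` with `C·γ₀ ≤ s`, the last-slot modulus `≤ C·g_k` along the in-window
runs, and (C) on the survivors ⟹ the crux decl (`runConstRemainder_of_lastSlotModulus`).  CONDITIONAL; instance 0∕1. [cite: Balaban1987RG1, Thm 3 p.264, (2.13) p.268 and (5.10) p.293] -/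
theorem EndpointGivenBR13SepCoPH_of_cornerDriftK_cornerLastSlotModulusK
    (h₁ : ∀ (F : T4Family) (θ : Node00.Stage13HParams F 2) (hP : θ.Provisos₁₃SepCoPH F 2),
      (θ.ZhUnity F 2 ∧ θ.SlotsNondegenerate₁₃ F 2) → θ.Admissible F 2 →
      B16.EndStatementBPrinted (Node00.datumOfRecord₁₃SepCoPH F 2 θ hP).C →
      (∃ γ₁ : ℝ, 0 < γ₁ ∧ ∀ γ : ℝ, 0 < γ → γ ≤ γ₁ →
        ∃ P : B12.RunParams, 1 ≤ P.K ∧ ((Node00.datumOfRecord₁₃SepCoPH F 2 θ hP).C P).flow.InInterval γ P.K) →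
      ∃ (b : ℕ → ℝ) (s A : ℝ), ScaleAnchor (Node00.datumOfRecord₁₃SepCoPH F 2 θ hP).βfun b ∧ 0 < s ∧ OneLoopDrift s A b)
    (h₂ : ∀ (F : T4Family) (θ : Node00.Stage13HParams F 2) (hP : θ.Provisos₁₃SepCoPH F 2),
      (θ.ZhUnity F 2 ∧ θ.SlotsNondegenerate₁₃ F 2) → θ.Admissible F 2 →
      B16.EndStatementBPrinted (Node00.datumOfRecord₁₃SepCoPH F 2 θ hP).C →
      (∃ γ₁ : ℝ, 0 < γ₁ ∧ ∀ γ : ℝ, 0 < γ → γ ≤ γ₁ →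
        ∃ P : B12.RunParams, 1 ≤ P.K ∧ ((Node00.datumOfRecord₁₃SepCoPH F 2 θ hP).C P).flow.InInterval γ P.K) →
      ∀ (b : ℕ → ℝ) (s A : ℝ), ScaleAnchor (Node00.datumOfRecord₁₃SepCoPH F 2 θ hP).βfun b → 0 < s → OneLoopDrift s A b →
      ∃ γ₀ C : ℝ, 0 < γ₀ ∧ 0 ≤ C ∧ C * γ₀ ≤ s ∧
        (∀ (n : ℕ) (gs : ℕ → ℝ), RGEqH n (Node00.datumOfRecord₁₃SepCoPH F 2 θ hP).βfun gs → Step.InInterval γ₀ n gs → ∀ k, k ≤ n →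
          |(Node00.datumOfRecord₁₃SepCoPH F 2 θ hP).βfun k (prefixOf gs k) - b k| ≤ C * gs k) ∧
        SurvCont (Node00.datumOfRecord₁₃SepCoPH F 2 θ hP).βfun γ₀) :
    Summit.QuantumFields.YangMills.Theses.BalabanUVNodes.EndpointGivenBR13SepCoPH := by
  refine EndpointGivenBR13SepCoPH_of_cornerDriftK_cornerRunConstRemainderK h₁ ?_
  intro F θ hP hU hθ hB hwin b s A hanch hs hdrift
  obtain ⟨γ₀, C, hγ₀, hC0, hwin', hmod, hcont⟩ := h₂ F θ hP hU hθ hB hwin b s A hanch hs hdrift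
  exact ⟨γ₀, C * γ₀, hγ₀, hwin', runConstRemainder_of_lastSlotModulus hC0 hmod, hcont⟩

/-- **(5d), ω-MODULUS CURRENCY (plan g84 (5d)'s text shape; idea-5 l.30900's rate-free caution honoured)**: 2ᶜᴰ and, at every anchored drifting `b`, SOME level `γ₀ > 0`, SOME modulus
`ω → 0` (g → 0⁺, no rate) with `|β_{k+1}(prefix) − b_k| ≤ ω(g_k)` along the level-`γ₀` runs, and (C) on the level-`γ₀` survivors ⟹ the crux decl: the window pays `r := s` at a smaller level
(`runConstRemainder_of_omegaModulus`) and (C) descends to it (`survCont_anti`, node N17's lane BY NAME).  `RunModulus` of the crux workfiles = the pair `(hω, hmod)` spelled inline (not a tree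
token); `γ₀ ≤ θ.γ` is not needed.  CONDITIONAL; instance 0∕1. [cite: Balaban1987RG1, Thm 3 p.264, (2.13) p.268 and (5.10) p.293] -/
theorem EndpointGivenBR13SepCoPH_of_cornerDriftK_cornerOmegaModulusK
    (h₁ : ∀ (F : T4Family) (θ : Node00.Stage13HParams F 2) (hP : θ.Provisos₁₃SepCoPH F 2),
      (θ.ZhUnity F 2 ∧ θ.SlotsNondegenerate₁₃ F 2) → θ.Admissible F 2 →
      B16.EndStatementBPrinted (Node00.datumOfRecord₁₃SepCoPH F 2 θ hP).C →
      (∃ γ₁ : ℝ, 0 < γ₁ ∧ ∀ γ : ℝ, 0 < γ → γ ≤ γ₁ →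
        ∃ P : B12.RunParams, 1 ≤ P.K ∧ ((Node00.datumOfRecord₁₃SepCoPH F 2 θ hP).C P).flow.InInterval γ P.K) →
      ∃ (b : ℕ → ℝ) (s A : ℝ), ScaleAnchor (Node00.datumOfRecord₁₃SepCoPH F 2 θ hP).βfun b ∧ 0 < s ∧ OneLoopDrift s A b)
    (h₂ : ∀ (F : T4Family) (θ : Node00.Stage13HParams F 2) (hP : θ.Provisos₁₃SepCoPH F 2),
      (θ.ZhUnity F 2 ∧ θ.SlotsNondegenerate₁₃ F 2) → θ.Admissible F 2 →
      B16.EndStatementBPrinted (Node00.datumOfRecord₁₃SepCoPH F 2 θ hP).C →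
      (∃ γ₁ : ℝ, 0 < γ₁ ∧ ∀ γ : ℝ, 0 < γ → γ ≤ γ₁ →
        ∃ P : B12.RunParams, 1 ≤ P.K ∧ ((Node00.datumOfRecord₁₃SepCoPH F 2 θ hP).C P).flow.InInterval γ P.K) →
      ∀ (b : ℕ → ℝ) (s A : ℝ), ScaleAnchor (Node00.datumOfRecord₁₃SepCoPH F 2 θ hP).βfun b → 0 < s → OneLoopDrift s A b →
      ∃ (γ₀ : ℝ) (ω : ℝ → ℝ), 0 < γ₀ ∧ Filter.Tendsto ω (nhdsWithin 0 (Set.Ioi 0)) (nhds 0) ∧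
        (∀ (n : ℕ) (gs : ℕ → ℝ), RGEqH n (Node00.datumOfRecord₁₃SepCoPH F 2 θ hP).βfun gs → Step.InInterval γ₀ n gs → ∀ k, k ≤ n →
          |(Node00.datumOfRecord₁₃SepCoPH F 2 θ hP).βfun k (prefixOf gs k) - b k| ≤ ω (gs k)) ∧
        SurvCont (Node00.datumOfRecord₁₃SepCoPH F 2 θ hP).βfun γ₀) :
    Summit.QuantumFields.YangMills.Theses.BalabanUVNodes.EndpointGivenBR13SepCoPH := by
  refine EndpointGivenBR13SepCoPH_of_cornerDriftK_cornerRunConstRemainderK h₁ ?_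
  intro F θ hP hU hθ hB hwin b s A hanch hs hdrift
  obtain ⟨γ₀, ω, hγ₀, hω, hmod, hcont⟩ := h₂ F θ hP hU hθ hB hwin b s A hanch hs hdrift
  obtain ⟨γ₁, hγ₁, hle, hrem⟩ := runConstRemainder_of_omegaModulus hω hmod hγ₀ hs
  exact ⟨γ₁, s, hγ₁, le_rfl, hrem, survCont_anti hγ₁ hle hcont⟩

/-- **SUPPLIERS OF THE WEAK CURRENCY FEED THE REGISTERED 1ᶜᴿ TEXT (v7c :549, INLINE), modulo toy representability**: at every anchored drifting `b`, a constants package with the cap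
`≤ s`, a representability radius `ρ` at those constants (`hrepr`; NOT constructed anywhere), a run-wise constant remainder of radius `ρ` and (C) on the survivors ⟹ 1ᶜᴿ's text.  CONDITIONAL.
[cite: Balaban1987RG1, (1.20)-(1.22) p.264 and (5.10) p.293; Balaban1988RG2Cluster, Lemma 3 (2.38) p.20] -/
theorem cornerRunChainK_of_reprRadius_cornerRunConstRemainderK
    (h : ∀ (F : T4Family) (θ : Node00.Stage13HParams F 2) (hP : θ.Provisos₁₃SepCoPH F 2),
      (θ.ZhUnity F 2 ∧ θ.SlotsNondegenerate₁₃ F 2) → θ.Admissible F 2 →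
      B16.EndStatementBPrinted (Node00.datumOfRecord₁₃SepCoPH F 2 θ hP).C →
      (∃ γ₁ : ℝ, 0 < γ₁ ∧ ∀ γ : ℝ, 0 < γ → γ ≤ γ₁ →
        ∃ P : B12.RunParams, 1 ≤ P.K ∧ ((Node00.datumOfRecord₁₃SepCoPH F 2 θ hP).C P).flow.InInterval γ P.K) →
      ∀ (b : ℕ → ℝ) (s A : ℝ), ScaleAnchor (Node00.datumOfRecord₁₃SepCoPH F 2 θ hP).βfun b → 0 < s → OneLoopDrift s A b →
      ∃ (M : ℕ) (_ : NeZero M) (μ ν : Fin 4) (c : B13.Consts) (ℓ α₂ : ℝ) (q : Consts190) (γ₀ ρ : ℝ),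
        CondsL 4 c ℓ ∧ c.R22gen ℓ ∧ q.Valid c.δ₀ ∧ SignsL c α₂ q.B₃ ∧ 0 < γ₀ ∧ c.ε₁ * remCoeffL 4 M c α₂ q.B₃ ≤ s ∧
        (∀ r : ℝ, |r| ≤ ρ →
          ∃ a : LDom 4 → Pt 4 → ℝ, B12Beta.secondMoment (fun _ _ => limKernel a) μ ν = r ∧ Nonempty (PolLeavesTFac190H 4 M a c ℓ α₂ q)) ∧
        RunConstRemainder (Node00.datumOfRecord₁₃SepCoPH F 2 θ hP).βfun b ρ γ₀ ∧
        SurvCont (Node00.datumOfRecord₁₃SepCoPH F 2 θ hP).βfun γ₀) :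
    ∀ (F : T4Family) (θ : Node00.Stage13HParams F 2) (hP : θ.Provisos₁₃SepCoPH F 2),
      (θ.ZhUnity F 2 ∧ θ.SlotsNondegenerate₁₃ F 2) → θ.Admissible F 2 →
      B16.EndStatementBPrinted (Node00.datumOfRecord₁₃SepCoPH F 2 θ hP).C →
      (∃ γ₁ : ℝ, 0 < γ₁ ∧ ∀ γ : ℝ, 0 < γ → γ ≤ γ₁ →
        ∃ P : B12.RunParams, 1 ≤ P.K ∧ ((Node00.datumOfRecord₁₃SepCoPH F 2 θ hP).C P).flow.InInterval γ P.K) →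
      ∀ (b : ℕ → ℝ) (s A : ℝ), ScaleAnchor (Node00.datumOfRecord₁₃SepCoPH F 2 θ hP).βfun b → 0 < s → OneLoopDrift s A b →
      ∃ (M : ℕ) (_ : NeZero M) (μ ν : Fin 4) (c : B13.Consts) (ℓ α₂ : ℝ) (q : Consts190) (γ₀ : ℝ),
        (∀ (n : ℕ) (gs : ℕ → ℝ), RGEqH n (Node00.datumOfRecord₁₃SepCoPH F 2 θ hP).βfun gs → Step.InInterval γ₀ n gs → ∀ k, k ≤ n →
          ∃ a : LDom 4 → Pt 4 → ℝ, (Node00.datumOfRecord₁₃SepCoPH F 2 θ hP).βfun k (prefixOf gs k) - b k =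
            B12Beta.secondMoment (fun _ _ => limKernel a) μ ν ∧ Nonempty (PolLeavesTFac190H 4 M a c ℓ α₂ q)) ∧
        CondsL 4 c ℓ ∧ c.R22gen ℓ ∧ q.Valid c.δ₀ ∧ SignsL c α₂ q.B₃ ∧ 0 < γ₀ ∧
        c.ε₁ * remCoeffL 4 M c α₂ q.B₃ ≤ s ∧ SurvCont (Node00.datumOfRecord₁₃SepCoPH F 2 θ hP).βfun γ₀ := by
  intro F θ hP hU hθ hB hwin b s A hanch hs hdrift
  obtain ⟨M, instM, μ, ν, c, ℓ, α₂, q, γ₀, ρ, hC, h22, hq, hsg, hγ₀, hcap, hrepr, hrem, hcont⟩ :=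
    h F θ hP hU hθ hB hwin b s A hanch hs hdrift
  exact ownRunRowsBody_of_reprRadius_runConstRemainder F θ hP hC h22 hq hsg hγ₀ hcap hrepr hrem hcont

/-- **… and the REGISTERED 1ᶜᴿ TEXT IMPLIES §4's weak hypothesis** (right end of the sandwich + the cap, at the anchored `b`): the corner stub, as typed, is sandwiched exactly as §1–§2 say.
[cite: Balaban1987RG1, (5.10) p.293; Balaban1988RG2Cluster, Lemma 3 (2.38) p.20] -/
theorem cornerRunConstRemainderK_of_cornerRunChainK
    (h : ∀ (F : T4Family) (θ : Node00.Stage13HParams F 2) (hP : θ.Provisos₁₃SepCoPH F 2),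
      (θ.ZhUnity F 2 ∧ θ.SlotsNondegenerate₁₃ F 2) → θ.Admissible F 2 →
      B16.EndStatementBPrinted (Node00.datumOfRecord₁₃SepCoPH F 2 θ hP).C →
      (∃ γ₁ : ℝ, 0 < γ₁ ∧ ∀ γ : ℝ, 0 < γ → γ ≤ γ₁ →
        ∃ P : B12.RunParams, 1 ≤ P.K ∧ ((Node00.datumOfRecord₁₃SepCoPH F 2 θ hP).C P).flow.InInterval γ P.K) →
      ∀ (b : ℕ → ℝ) (s A : ℝ), ScaleAnchor (Node00.datumOfRecord₁₃SepCoPH F 2 θ hP).βfun b → 0 < s → OneLoopDrift s A b →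
      ∃ (M : ℕ) (_ : NeZero M) (μ ν : Fin 4) (c : B13.Consts) (ℓ α₂ : ℝ) (q : Consts190) (γ₀ : ℝ),
        (∀ (n : ℕ) (gs : ℕ → ℝ), RGEqH n (Node00.datumOfRecord₁₃SepCoPH F 2 θ hP).βfun gs → Step.InInterval γ₀ n gs → ∀ k, k ≤ n →
          ∃ a : LDom 4 → Pt 4 → ℝ, (Node00.datumOfRecord₁₃SepCoPH F 2 θ hP).βfun k (prefixOf gs k) - b k =
            B12Beta.secondMoment (fun _ _ => limKernel a) μ ν ∧ Nonempty (PolLeavesTFac190H 4 M a c ℓ α₂ q)) ∧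
        CondsL 4 c ℓ ∧ c.R22gen ℓ ∧ q.Valid c.δ₀ ∧ SignsL c α₂ q.B₃ ∧ 0 < γ₀ ∧
        c.ε₁ * remCoeffL 4 M c α₂ q.B₃ ≤ s ∧ SurvCont (Node00.datumOfRecord₁₃SepCoPH F 2 θ hP).βfun γ₀) :
    ∀ (F : T4Family) (θ : Node00.Stage13HParams F 2) (hP : θ.Provisos₁₃SepCoPH F 2),
      (θ.ZhUnity F 2 ∧ θ.SlotsNondegenerate₁₃ F 2) → θ.Admissible F 2 →
      B16.EndStatementBPrinted (Node00.datumOfRecord₁₃SepCoPH F 2 θ hP).C →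
      (∃ γ₁ : ℝ, 0 < γ₁ ∧ ∀ γ : ℝ, 0 < γ → γ ≤ γ₁ →
        ∃ P : B12.RunParams, 1 ≤ P.K ∧ ((Node00.datumOfRecord₁₃SepCoPH F 2 θ hP).C P).flow.InInterval γ P.K) →
      ∀ (b : ℕ → ℝ) (s A : ℝ), ScaleAnchor (Node00.datumOfRecord₁₃SepCoPH F 2 θ hP).βfun b → 0 < s → OneLoopDrift s A b →
      ∃ γ₀ r : ℝ, 0 < γ₀ ∧ r ≤ s ∧ RunConstRemainder (Node00.datumOfRecord₁₃SepCoPH F 2 θ hP).βfun b r γ₀ ∧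
        SurvCont (Node00.datumOfRecord₁₃SepCoPH F 2 θ hP).βfun γ₀ := by
  intro F θ hP hU hθ hB hwin b s A hanch hs hdrift
  obtain ⟨γ₀, hγ₀, hrem, hcont⟩ := runConstRemainder_slope_of_runRowsBody F θ hP (h F θ hP hU hθ hB hwin b s A hanch hs hdrift)
  exact ⟨γ₀, s, hγ₀, le_rfl, hrem, hcont⟩

end Corner

end Summit.QuantumFields.YangMills.Theorems.BalabanUVNodesK2RunRowsSandwich

end
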